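import Mathlib.Analysis.SpecialFunctions.Log.Base
import Mathlib.Analysis.SpecialFunctions.Pow.Real
import Mathlib.Analysis.Asymptotics.Lemmas
import Mathlib.Analysis.Complex.ExponentialBounds
import Mathlib.Combinatorics.Additive.AP.Three.Behrend
import Mathlib.NumberTheory.Bertrand
import Mathlib.Data.Nat.Choose.Bounds
import Literature.Computability.AlgebraicComplexity.MatrixMultiplicationExponent
import Literature.Computability.AlgebraicComplexity.AsymptoticSpectrum
import Literature.Computability.AlgebraicComplexity.FlatteningBound
import Literature.Computability.AlgebraicComplexity.BorderRankCW
import Literature.Computability.AlgebraicComplexity.CoppersmithWinograd1990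
import Literature.Computability.AlgebraicComplexity.TensorRestrictionRank
import Literature.Computability.AlgebraicComplexity.LaserHashing
import Literature.Computability.AlgebraicComplexity.CwLaserBlocks
import HarnessLib

/-!
# Proof of the Coppersmith–Winograd bound `ω ≤ log_q(4 R̃(T_cw,q)³/27)`
(discharge of `CoppersmithWinograd1990_asymptoticRank_form`)

Topic `Literature/Computability/AlgebraicComplexity`; sibling of `CoppersmithWinograd1990.lean`,
whose named fact `CoppersmithWinograd1990_asymptoticRank_form` — for `q ≥ 2`, `ρ > 0`:
`(∀ ε > 0, R(T_cw,q^{⊠N}) = O(ρ^{(1+ε)N})) → ω(ℂ) ≤ log_q(4ρ³/27)` (Conner–Gesmundo–Landsberg–Ventura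
2022, Thm. 1.1 with p. 3: "[BCS97, Ex. 15.24] observes that Theorem 1.1 holds replacing
`bR(T^{⊠k})^{1/k}` with the asymptotic rank"; Bürgisser–Clausen–Shokrollahi 1997, Rem. 15.44 and
Ex. 15.24(7); Bläser 2013, §9.2, p. 47) — is PROVED here:
`CoppersmithWinograd1990_asymptoticRank_form_holds`.

The companion fact `CoppersmithWinograd1990_rank_form` — CGLV Thm. 1.1 (arXiv Thm. 1.2) with the
rank `R` in place of the border rank: `q ≥ 2`, `k ≥ 1 ⇒ ω(ℂ) ≤ log_q((4/27) R(T_cw,q^{⊠k})^{3/k})` —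
is PROVED at the end (`CoppersmithWinograd1990_rank_form_holds`, section `RankForm`) as a corollary:
with `r = R(T_cw,q^{⊠k})` and `ρ = r^{1/k}`, submultiplicativity of the rank under Kronecker products
(CGLV p. 3; Bläser 2013, Lemma 5.8) gives `R(T_cw,q^{⊠N}) ≤ M^k ρ^N`, the hypothesis of the
asymptotic-rank form, whose conclusion `ω ≤ log_q(4ρ³/27)` is the claim (`ρ³ = r^{3/k}`).

## The proof (a restriction-only laser method)

The printed proofs (BCS §15.7–15.8; Bläser §9) run: type-restrict the `N = 3m`-th power to the
balanced blocks, hash (Thm. 15.39) to a diagonal of `≈ binom(3m,m) 2^{-o(m)}` blocks each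
`≃ ⟨q^m,q^m,q^m⟩`, apply the asymptotic sum inequality. They use a DEGENERATION at one place
(Lemma 15.36, the diagonal of `Ψ_M`); replacing it by Coppersmith–Winograd's original Salem–Spencer
set (`LaserHashing.exists_zeroSum_diagonal`, Behrend's bound from Mathlib) every step becomes a
zeroing-out, so that ranks (not border ranks) suffice throughout:

* `exists_free_balanced_diagonal` — the balanced support `Φ_m` (ordered partitions of `3m` positions
  into three `m`-blocks) is `2`-tight with fibres `C(2m,m)`; the hashing theorem
  `BCS1997_thm1539_free` (`LaserHashing.lean`) with a Bertrand prime `6C(2m,m) < M ≤ 12C(2m,m)` gives a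
  free diagonal `Δ_m` with `288 C(2m,m) |Δ_m| ≥ C(3m,m) · rothNumberNat(3C(2m,m))`.
* `exists_restrictsTo_cw_kroneckerPow` — by `cw_kroneckerPow_blocks` (`CwLaserBlocks.lean`),
  `T_cw,q^{⊗3m} ≥ ⟨|Δ_m|⟩ ⊗ ⟨q^m,q^m,q^m⟩` (BCS p. 381).
* the rank step of the asymptotic sum inequality (`TensorRestrictionRank.lean`, BCS p. 380): with
  `a = ⌊(|Δ_m|/C_δ)^{1/(ω+δ)}⌋`, `R(⟨a,a,a⟩) ≤ |Δ_m|`, hence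
  `(a q^m)^ω ≤ R(T^{⊗3m}) ≤ C_ε ρ^{3m(1+ε)}`;
* `pow_le_mul_choose_three_mul` (`C(3m,m) ≥ (27/4)^m/(3m+1)`), Behrend, and `m → ∞`, `δ, ε → 0`:
  `log(27/4) + ω log q ≤ 3 log ρ`, i.e. `ω ≤ log_q(4ρ³/27)`.

## References

* A. Conner, F. Gesmundo, J. M. Landsberg, E. Ventura, *Rank and border rank of Kronecker powers of
  tensors and Strassen's laser method*, comput. complexity 31 (2022) = arXiv:1909.04785, Thm. 1.1
  (arXiv Thm. 1.2) and p. 3–4. [ConnerGesmundoLandsbergVentura2022]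
* P. Bürgisser, M. Clausen, M. A. Shokrollahi, *Algebraic Complexity Theory* (1997), (15.11) and
  its proof p. 380, Thm. 15.39, Thm. 15.41 and its proof pp. 381–383, Rem. 15.44, Ex. 15.24(7).
  [BurgisserClausenShokrollahi1997]
* D. Coppersmith, S. Winograd, J. Symbolic Comput. 9 (1990) 251–280, §6. [CoppersmithWinograd1990]
* M. Bläser, *Fast Matrix Multiplication*, ToC Graduate Surveys 5 (2013), §9.2 (pp. 45–47).
  [Blaser2013]
-/

noncomputable section

open scoped BigOperators
open Filter Asymptotics Finset

namespace Literature.Computability.AlgebraicComplexity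

universe u

/-! ## The balanced support `Φ_m` of `T_cw,q^{⊗3m}` (BCS p. 381: `Φ = (I_μ × J_ν × L_π) ∩ (supp_D t)^N`) -/

section Support

/-- Members of the balanced support: ordered partitions `(A,B,C)` of the `3m` positions into three
blocks of size `m` (written as the pairwise disjoint triples of `m`-sets; the covering and the
complement formulas follow by counting). [cite: BurgisserClausenShokrollahi1997, Thm. 15.41 (proof, p. 381)] -/
theorem mem_balancedSupport {m : ℕ} {φ : Finset (Fin (3 * m)) × Finset (Fin (3 * m)) × Finset (Fin (3 * m))}
    (hφ : φ ∈ ((Finset.univ.powersetCard m) ×ˢ (Finset.univ.powersetCard m) ×ˢ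
      (Finset.univ.powersetCard m)).filter fun t : Finset (Fin (3 * m)) × Finset (Fin (3 * m)) ×
        Finset (Fin (3 * m)) => Disjoint t.1 t.2.1 ∧ Disjoint t.1 t.2.2 ∧ Disjoint t.2.1 t.2.2) :
    (φ.1.card = m ∧ φ.2.1.card = m ∧ φ.2.2.card = m) ∧
    (Disjoint φ.1 φ.2.1 ∧ Disjoint φ.1 φ.2.2 ∧ Disjoint φ.2.1 φ.2.2) ∧
    φ.1 ∪ φ.2.1 ∪ φ.2.2 = Finset.univ ∧ φ.2.2 = (φ.1 ∪ φ.2.1)ᶜ ∧ φ.2.1 = (φ.1 ∪ φ.2.2)ᶜ ∧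
    φ.1 = (φ.2.1 ∪ φ.2.2)ᶜ := by
  simp only [Finset.mem_filter, Finset.mem_product, Finset.mem_powersetCard] at hφ
  obtain ⟨⟨⟨-, hA⟩, ⟨-, hB⟩, ⟨-, hC⟩⟩, hab, hac, hbc⟩ := hφ
  have hcardU : (φ.1 ∪ φ.2.1 ∪ φ.2.2).card = 3 * m := by
    rw [Finset.card_union_of_disjoint (Finset.disjoint_union_left.2 ⟨hac, hbc⟩),
      Finset.card_union_of_disjoint hab, hA, hB, hC]; ring
  have hcov : φ.1 ∪ φ.2.1 ∪ φ.2.2 = Finset.univ :=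
    Finset.eq_univ_of_card _ (by rw [hcardU, Fintype.card_fin])
  refine ⟨⟨hA, hB, hC⟩, ⟨hab, hac, hbc⟩, hcov, ?_, ?_, ?_⟩
  · ext ρ
    have := Finset.eq_univ_iff_forall.1 hcov ρ
    simp only [Finset.mem_union, Finset.mem_compl, not_or] at this ⊢
    constructor
    · intro h; exact ⟨Finset.disjoint_right.1 hac h, Finset.disjoint_right.1 hbc h⟩
    · intro h; tauto
  · ext ρ
    have := Finset.eq_univ_iff_forall.1 hcov ρ
    simp only [Finset.mem_union, Finset.mem_compl, not_or] at this ⊢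
    constructor
    · intro h; exact ⟨Finset.disjoint_right.1 hab h, Finset.disjoint_left.1 hbc h⟩
    · intro h; tauto
  · ext ρ
    have := Finset.eq_univ_iff_forall.1 hcov ρ
    simp only [Finset.mem_union, Finset.mem_compl, not_or] at this ⊢
    constructor
    · intro h; exact ⟨Finset.disjoint_left.1 hab h, Finset.disjoint_left.1 hac h⟩
    · intro h; tauto

/-- Fibres of the balanced support over the first coordinate have at most `C(2m, m)` elements
(BCS p. 381: "the projection `Φ → I_μ` is surjective and all its fibres have cardinality
`|Φ|/|I_μ|`"; here only the upper bound, for an arbitrary set `P` of balanced ordered partitions).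
[cite: BurgisserClausenShokrollahi1997, Thm. 15.41 (proof, p. 381)] -/
theorem card_fibre_fst_le {m : ℕ}
    (P : Finset (Finset (Fin (3 * m)) × Finset (Fin (3 * m)) × Finset (Fin (3 * m))))
    (hP : ∀ φ ∈ P, φ.1.card = m ∧ φ.2.1.card = m ∧ Disjoint φ.1 φ.2.1 ∧ φ.2.2 = (φ.1 ∪ φ.2.1)ᶜ)
    (A : Finset (Fin (3 * m))) : (P.filter fun φ => φ.1 = A).card ≤ (2 * m).choose m := by
  classical
  by_cases hA : A.card = m
  · have hAc : Aᶜ.card = 2 * m := by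
      rw [Finset.card_compl, Fintype.card_fin, hA]; omega
    rw [← hAc, ← Finset.card_powersetCard]
    refine Finset.card_le_card_of_injOn (fun φ => φ.2.1) (fun φ hφ => ?_) ?_
    · simp only [Finset.coe_filter, Set.mem_setOf_eq] at hφ
      obtain ⟨h1, h2, h3, -⟩ := hP φ hφ.1
      simp only [Finset.mem_coe, Finset.mem_powersetCard]
      refine ⟨fun ρ hρ => Finset.mem_compl.2 fun hρA => ?_, h2⟩
      exact Finset.disjoint_right.1 h3 hρ (hφ.2 ▸ hρA)
    · intro φ hφ ψ hψ h
      simp only [Finset.coe_filter, Set.mem_setOf_eq] at hφ hψ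
      have e1 : φ.1 = ψ.1 := hφ.2.trans hψ.2.symm
      have e3 : φ.2.2 = ψ.2.2 := by
        rw [(hP φ hφ.1).2.2.2, (hP ψ hψ.1).2.2.2, e1]; simp only at h; rw [h]
      exact Prod.ext e1 (Prod.ext h e3)
  · have : P.filter (fun φ => φ.1 = A) = ∅ := by
      refine Finset.filter_eq_empty_iff.2 fun φ hφ h => hA ?_
      rw [← h]; exact (hP φ hφ).1
    rw [this, Finset.card_empty]; exact Nat.zero_le _

/-- Fibres over the second coordinate have at most `C(2m, m)` elements. [cite: BurgisserClausenShokrollahi1997, Thm. 15.41 (proof, p. 381)] -/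
theorem card_fibre_snd_le {m : ℕ}
    (P : Finset (Finset (Fin (3 * m)) × Finset (Fin (3 * m)) × Finset (Fin (3 * m))))
    (hP : ∀ φ ∈ P, φ.1.card = m ∧ φ.2.1.card = m ∧ Disjoint φ.1 φ.2.1 ∧ φ.2.2 = (φ.1 ∪ φ.2.1)ᶜ)
    (B : Finset (Fin (3 * m))) : (P.filter fun φ => φ.2.1 = B).card ≤ (2 * m).choose m := by
  classical
  by_cases hB : B.card = m
  · have hBc : Bᶜ.card = 2 * m := by
      rw [Finset.card_compl, Fintype.card_fin, hB]; omega
    rw [← hBc, ← Finset.card_powersetCard]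
    refine Finset.card_le_card_of_injOn (fun φ => φ.1) (fun φ hφ => ?_) ?_
    · simp only [Finset.coe_filter, Set.mem_setOf_eq] at hφ
      obtain ⟨h1, h2, h3, -⟩ := hP φ hφ.1
      simp only [Finset.mem_coe, Finset.mem_powersetCard]
      refine ⟨fun ρ hρ => Finset.mem_compl.2 fun hρB => ?_, h1⟩
      exact Finset.disjoint_left.1 h3 hρ (hφ.2 ▸ hρB)
    · intro φ hφ ψ hψ h
      simp only [Finset.coe_filter, Set.mem_setOf_eq] at hφ hψ
      have e2 : φ.2.1 = ψ.2.1 := hφ.2.trans hψ.2.symm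
      have e3 : φ.2.2 = ψ.2.2 := by
        rw [(hP φ hφ.1).2.2.2, (hP ψ hψ.1).2.2.2, e2]; simp only at h; rw [h]
      exact Prod.ext h (Prod.ext e2 e3)
  · have : P.filter (fun φ => φ.2.1 = B) = ∅ := by
      refine Finset.filter_eq_empty_iff.2 fun φ hφ h => hB ?_
      rw [← h]; exact (hP φ hφ).2.1
    rw [this, Finset.card_empty]; exact Nat.zero_le _

/-- Fibres over the third coordinate have at most `C(2m, m)` elements. [cite: BurgisserClausenShokrollahi1997, Thm. 15.41 (proof, p. 381)] -/
theorem card_fibre_thd_le {m : ℕ}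
    (P : Finset (Finset (Fin (3 * m)) × Finset (Fin (3 * m)) × Finset (Fin (3 * m))))
    (hP : ∀ φ ∈ P, φ.1.card = m ∧ φ.2.2.card = m ∧ Disjoint φ.1 φ.2.2 ∧ φ.2.1 = (φ.1 ∪ φ.2.2)ᶜ)
    (C : Finset (Fin (3 * m))) : (P.filter fun φ => φ.2.2 = C).card ≤ (2 * m).choose m := by
  classical
  by_cases hC : C.card = m
  · have hCc : Cᶜ.card = 2 * m := by
      rw [Finset.card_compl, Fintype.card_fin, hC]; omega
    rw [← hCc, ← Finset.card_powersetCard]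
    refine Finset.card_le_card_of_injOn (fun φ => φ.1) (fun φ hφ => ?_) ?_
    · simp only [Finset.coe_filter, Set.mem_setOf_eq] at hφ
      obtain ⟨h1, h2, h3, -⟩ := hP φ hφ.1
      simp only [Finset.mem_coe, Finset.mem_powersetCard]
      refine ⟨fun ρ hρ => Finset.mem_compl.2 fun hρC => ?_, h1⟩
      exact Finset.disjoint_left.1 h3 hρ (hφ.2 ▸ hρC)
    · intro φ hφ ψ hψ h
      simp only [Finset.coe_filter, Set.mem_setOf_eq] at hφ hψ
      have e3 : φ.2.2 = ψ.2.2 := hφ.2.trans hψ.2.symm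
      have e2 : φ.2.1 = ψ.2.1 := by
        rw [(hP φ hφ.1).2.2.2, (hP ψ hψ.1).2.2.2, e3]; simp only at h; rw [h]
      exact Prod.ext h (Prod.ext e2 e3)
  · have : P.filter (fun φ => φ.2.2 = C) = ∅ := by
      refine Finset.filter_eq_empty_iff.2 fun φ hφ h => hC ?_
      rw [← h]; exact (hP φ hφ).2.1
    rw [this, Finset.card_empty]; exact Nat.zero_le _

/-- The balanced support has at least `C(3m,m) · C(2m,m)` elements (choose `A`, then `B ⊆ Aᶜ`;
BCS p. 381: `|I_μ| = binom(N, μ)`, fibres of size `|Φ|/|I_μ|`). [cite: BurgisserClausenShokrollahi1997, Thm. 15.41 (proof, p. 381)] -/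
theorem card_balancedSupport_ge (m : ℕ) :
    (3 * m).choose m * (2 * m).choose m ≤
      (((Finset.univ.powersetCard m) ×ˢ (Finset.univ.powersetCard m) ×ˢ
        (Finset.univ.powersetCard m)).filter fun t : Finset (Fin (3 * m)) × Finset (Fin (3 * m)) ×
          Finset (Fin (3 * m)) => Disjoint t.1 t.2.1 ∧ Disjoint t.1 t.2.2 ∧ Disjoint t.2.1 t.2.2).card := by
  classical
  -- the pairs `(A, B)` with `|A| = m`, `B ⊆ Aᶜ`, `|B| = m`
  set S := ((Finset.univ : Finset (Fin (3 * m))).powersetCard m).sigma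
    fun A => Aᶜ.powersetCard m with hS
  have hScard : S.card = (3 * m).choose m * (2 * m).choose m := by
    rw [hS, Finset.card_sigma]
    have : ∀ A ∈ (Finset.univ : Finset (Fin (3 * m))).powersetCard m,
        (Aᶜ.powersetCard m).card = (2 * m).choose m := by
      intro A hA
      rw [Finset.card_powersetCard, Finset.card_compl, Fintype.card_fin,
        (Finset.mem_powersetCard.1 hA).2]
      congr 1; omega
    rw [Finset.sum_congr rfl this, Finset.sum_const, smul_eq_mul, Finset.card_powersetCard,
      Finset.card_univ, Fintype.card_fin]
  rw [← hScard]
  refine Finset.card_le_card_of_injOn (fun p => (p.1, p.2, (p.1 ∪ p.2)ᶜ)) (fun p hp => ?_) ?_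
  · simp only [hS, Finset.coe_sigma, Set.mem_sigma_iff, Finset.mem_coe,
      Finset.mem_powersetCard] at hp
    obtain ⟨⟨-, hA⟩, hBsub, hB⟩ := hp
    have hdisj : Disjoint p.1 p.2 := Finset.disjoint_left.2 fun ρ hρA hρB =>
      (Finset.mem_compl.1 (hBsub hρB)) hρA
    simp only [Finset.mem_coe, Finset.mem_filter, Finset.mem_product, Finset.mem_powersetCard,
      Finset.subset_univ, true_and]
    refine ⟨⟨hA, hB, ?_⟩, hdisj, disjoint_compl_right.mono_left Finset.subset_union_left,
      disjoint_compl_right.mono_left Finset.subset_union_right⟩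
    rw [Finset.card_compl, Fintype.card_fin, Finset.card_union_of_disjoint hdisj, hA, hB]
    omega
  · intro p _ p' _ h
    simp only [Prod.mk.injEq] at h
    exact Sigma.ext h.1 (heq_of_eq h.2.1)

/-- **A large free diagonal of balanced partitions** — the combinatorial half of the laser method
for `T_cw,q` (BCS Thm. 15.41, proof, step (B): a diagonal `Δ ⊆ Φ` with
`|Δ| ≥ C · min binom(N, μ)`, via Thm. 15.39 applied to the `2`-tight set `Φ`): for every `m ≥ 1`
there is a family `Δ` of ordered partitions of `{1,…,3m}` into blocks of size `m`, which is a free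
diagonal, with `288 · C(2m,m) · |Δ| ≥ C(3m,m) · rothNumberNat(3 C(2m,m))` (hashing theorem with a
Bertrand prime `6 C(2m,m) < M ≤ 12 C(2m,m)` and the Salem–Spencer diagonal of size
`≥ rothNumberNat(M/2)`). [cite: BurgisserClausenShokrollahi1997, Thm. 15.41 (proof, p. 381)] -/
theorem exists_free_balanced_diagonal (m : ℕ) (hm : 1 ≤ m) :
    ∃ Δ : Finset (Finset (Fin (3 * m)) × Finset (Fin (3 * m)) × Finset (Fin (3 * m))),
      (∀ δ ∈ Δ, δ.1.card = m ∧ δ.2.1.card = m ∧ δ.2.2.card = m) ∧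
      (∀ δ ∈ Δ, Disjoint δ.1 δ.2.1 ∧ Disjoint δ.1 δ.2.2 ∧ Disjoint δ.2.1 δ.2.2 ∧
        δ.1 ∪ δ.2.1 ∪ δ.2.2 = Finset.univ) ∧
      (∀ δ ∈ Δ, ∀ δ' ∈ Δ, ∀ δ'' ∈ Δ, Disjoint δ.1 δ'.2.1 → Disjoint δ.1 δ''.2.2 →
        Disjoint δ'.2.1 δ''.2.2 → δ.1 ∪ δ'.2.1 ∪ δ''.2.2 = Finset.univ → δ = δ' ∧ δ' = δ'') ∧
      (3 * m).choose m * rothNumberNat (3 * (2 * m).choose m) ≤ 288 * (2 * m).choose m * Δ.card := by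
  classical
  -- the tightness maps
  let ind : Finset (Fin (3 * m)) → Fin (3 * m) → ℤ := fun A ρ => if ρ ∈ A then -2 else 1
  have hind_inj : Function.Injective ind := by
    intro A A' h
    ext ρ
    have h' := congrFun h ρ
    simp only [ind] at h'
    by_cases h1 : ρ ∈ A
    · by_cases h2 : ρ ∈ A'
      · exact iff_of_true h1 h2
      · rw [if_pos h1, if_neg h2] at h'; norm_num at h'
    · by_cases h2 : ρ ∈ A'
      · rw [if_neg h1, if_pos h2] at h'; norm_num at h'
      · exact iff_of_false h1 h2
  have hind_bd : ∀ A ρ, |ind A ρ| ≤ 2 := by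
    intro A ρ; by_cases h : ρ ∈ A <;> simp [ind, h]
  -- the balanced support, made opaque
  obtain ⟨Φ, hΦ⟩ : ∃ Φ : Finset (Finset (Fin (3 * m)) × Finset (Fin (3 * m)) × Finset (Fin (3 * m))),
      Φ = ((Finset.univ.powersetCard m) ×ˢ (Finset.univ.powersetCard m) ×ˢ
        (Finset.univ.powersetCard m)).filter fun t : Finset (Fin (3 * m)) × Finset (Fin (3 * m)) ×
          Finset (Fin (3 * m)) => Disjoint t.1 t.2.1 ∧ Disjoint t.1 t.2.2 ∧ Disjoint t.2.1 t.2.2 :=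
    ⟨_, rfl⟩
  have hmem : ∀ φ ∈ Φ, (φ.1.card = m ∧ φ.2.1.card = m ∧ φ.2.2.card = m) ∧
      (Disjoint φ.1 φ.2.1 ∧ Disjoint φ.1 φ.2.2 ∧ Disjoint φ.2.1 φ.2.2) ∧
      φ.1 ∪ φ.2.1 ∪ φ.2.2 = Finset.univ ∧ φ.2.2 = (φ.1 ∪ φ.2.1)ᶜ ∧ φ.2.1 = (φ.1 ∪ φ.2.2)ᶜ ∧
      φ.1 = (φ.2.1 ∪ φ.2.2)ᶜ := fun φ hφ => mem_balancedSupport (hΦ ▸ hφ)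
  have hmemΦ : ∀ A B C : Finset (Fin (3 * m)), A.card = m → B.card = m → C.card = m →
      Disjoint A B → Disjoint A C → Disjoint B C → (A, B, C) ∈ Φ := by
    intro A B C hA hB hC h1 h2 h3
    rw [hΦ]
    exact Finset.mem_filter.2 ⟨Finset.mem_product.2 ⟨Finset.mem_powersetCard.2
      ⟨Finset.subset_univ _, hA⟩, Finset.mem_product.2 ⟨Finset.mem_powersetCard.2
      ⟨Finset.subset_univ _, hB⟩, Finset.mem_powersetCard.2 ⟨Finset.subset_univ _, hC⟩⟩⟩, h1, h2, h3⟩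
  have hΦcard : (3 * m).choose m * (2 * m).choose m ≤ Φ.card := hΦ ▸ card_balancedSupport_ge m
  have htight : ∀ φ ∈ Φ, ∀ ρ, ind φ.1 ρ + ind φ.2.1 ρ + ind φ.2.2 ρ = 0 := by
    intro φ hφ ρ
    obtain ⟨-, ⟨hab, hac, hbc⟩, hcov, -⟩ := hmem φ hφ
    have := Finset.eq_univ_iff_forall.1 hcov ρ
    simp only [Finset.mem_union] at this
    rcases this with (h | h) | h
    · have h2 := Finset.disjoint_left.1 hab h
      have h3 := Finset.disjoint_left.1 hac h
      simp [ind, h, h2, h3]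
    · have h1 := Finset.disjoint_right.1 hab h
      have h3 := Finset.disjoint_left.1 hbc h
      simp [ind, h, h1, h3]
    · have h1 := Finset.disjoint_right.1 hac h
      have h2 := Finset.disjoint_right.1 hbc h
      simp [ind, h, h1, h2]
  -- fibres, of size at most `f = C(2m, m)` (made opaque)
  obtain ⟨f, hf⟩ : ∃ f : ℕ, f = (2 * m).choose m := ⟨_, rfl⟩
  have hf1 : 1 ≤ f := hf ▸ Nat.choose_pos (by omega)
  have hfI : ∀ A, (Φ.filter fun φ => φ.1 = A).card ≤ f := fun A => hf ▸ card_fibre_fst_le Φ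
    (fun φ hφ => by obtain ⟨⟨h1, h2, -⟩, ⟨h3, -⟩, -, h4, -⟩ := hmem φ hφ; exact ⟨h1, h2, h3, h4⟩) A
  have hfJ : ∀ B, (Φ.filter fun φ => φ.2.1 = B).card ≤ f := fun B => hf ▸ card_fibre_snd_le Φ
    (fun φ hφ => by obtain ⟨⟨h1, h2, -⟩, ⟨h3, -⟩, -, h4, -⟩ := hmem φ hφ; exact ⟨h1, h2, h3, h4⟩) B
  have hfL : ∀ C, (Φ.filter fun φ => φ.2.2 = C).card ≤ f := fun C => hf ▸ card_fibre_thd_le Φ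
    (fun φ hφ => by
      obtain ⟨⟨h1, -, h2⟩, ⟨-, h3, -⟩, -, -, h4, -⟩ := hmem φ hφ; exact ⟨h1, h2, h3, h4⟩) C
  -- a Bertrand prime `6f < M ≤ 12f`
  obtain ⟨M, hMp, hM1, hM2⟩ := Nat.exists_prime_lt_and_le_two_mul (6 * f) (by omega)
  haveI : NeZero M := ⟨hMp.ne_zero⟩
  have hM4 : 2 * 2 < M := by omega
  have hM3 : 2 * (M / 2) ≤ M := Nat.mul_div_le M 2
  have hfM : 3 * f ≤ M / 2 := by omega
  have hM12 : M ≤ 12 * f := by omega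
  -- the Salem–Spencer diagonal with `k = M / 2`
  obtain ⟨D₁, D₂, D₃, hD₁, hD₂, hD₃, hDcard⟩ := exists_zeroSum_diagonal M (M / 2) hM3
  -- the hashing theorem
  obtain ⟨Δ, hΔΦ, hfree, hsize⟩ := BCS1997_thm1539_free Φ (r := 3 * m) (b := 2) ind ind ind hind_inj
    hind_inj hind_inj hind_bd hind_bd htight hfI hfJ hfL hMp hM4 D₁ D₂ D₃ hD₁ hD₂ hD₃
  refine ⟨Δ, fun δ hδ => (hmem δ (hΔΦ hδ)).1, fun δ hδ => ⟨(hmem δ (hΔΦ hδ)).2.1.1,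
    (hmem δ (hΔΦ hδ)).2.1.2.1, (hmem δ (hΔΦ hδ)).2.1.2.2, (hmem δ (hΔΦ hδ)).2.2.1⟩, ?_, ?_⟩
  · -- freeness in partition form
    intro δ hδ δ' hδ' δ'' hδ'' h1 h2 h3 _
    exact hfree δ hδ δ' hδ' δ'' hδ'' (hmemΦ _ _ _ (hmem δ (hΔΦ hδ)).1.1
      (hmem δ' (hΔΦ hδ')).1.2.1 (hmem δ'' (hΔΦ hδ'')).1.2.2 h1 h2 h3)
  · -- the size bound, from `|Φ| |D| (M - 3f) ≤ M³ |Δ|` with `6f < M ≤ 12 f`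
    obtain ⟨D, hD⟩ : ∃ D : Finset (ZMod M × ZMod M × ZMod M),
        D = (D₁ ×ˢ D₂ ×ˢ D₃).filter fun d => d.1 + d.2.1 + d.2.2 = 0 := ⟨_, rfl⟩
    rw [← hD] at hsize hDcard
    have hroth : rothNumberNat (3 * f) ≤ D.card := (rothNumberNat.mono hfM).trans hDcard
    have hM0 : (0 : ℤ) < M := by exact_mod_cast hMp.pos
    have hf0 : (0 : ℤ) < f := by exact_mod_cast hf1
    have hΦD : (0 : ℤ) ≤ (Φ.card : ℤ) * D.card := mul_nonneg (Nat.cast_nonneg _) (Nat.cast_nonneg _)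
    have hM6 : (6 * f : ℤ) < M := by exact_mod_cast hM1
    have h1 : (Φ.card : ℤ) * D.card * M ≤ 2 * (M : ℤ) ^ 3 * Δ.card :=
      calc (Φ.card : ℤ) * D.card * M ≤ (Φ.card : ℤ) * D.card * (2 * ((M : ℤ) - 3 * f)) :=
            mul_le_mul_of_nonneg_left (by linarith only [hM6]) hΦD
        _ = 2 * ((Φ.card : ℤ) * D.card * ((M : ℤ) - 3 * f)) := by ring
        _ ≤ 2 * ((M : ℤ) ^ 3 * Δ.card) := mul_le_mul_of_nonneg_left hsize (by norm_num)
        _ = 2 * (M : ℤ) ^ 3 * Δ.card := by ring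
    have h2 : (Φ.card : ℤ) * D.card ≤ 2 * (M : ℤ) ^ 2 * Δ.card := by
      refine le_of_mul_le_mul_right ?_ hM0
      calc (Φ.card : ℤ) * D.card * M ≤ 2 * (M : ℤ) ^ 3 * Δ.card := h1
        _ = 2 * (M : ℤ) ^ 2 * Δ.card * M := by ring
    have hMsq : (M : ℤ) ^ 2 ≤ (12 * f : ℤ) ^ 2 :=
      pow_le_pow_left₀ hM0.le (by exact_mod_cast hM12) 2
    have h3 : ((3 * m).choose m : ℤ) * f * rothNumberNat (3 * f) ≤ 2 * (12 * (f : ℤ)) ^ 2 * Δ.card :=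
      calc ((3 * m).choose m : ℤ) * f * rothNumberNat (3 * f) ≤ (Φ.card : ℤ) * D.card := by
            have := Nat.mul_le_mul (hf ▸ hΦcard) hroth
            exact_mod_cast this
        _ ≤ 2 * (M : ℤ) ^ 2 * Δ.card := h2
        _ ≤ 2 * (12 * (f : ℤ)) ^ 2 * Δ.card :=
            mul_le_mul_of_nonneg_right (mul_le_mul_of_nonneg_left hMsq (by norm_num))
              (Nat.cast_nonneg _)
    have h4 : ((3 * m).choose m : ℤ) * rothNumberNat (3 * f) ≤ 288 * (f : ℤ) * Δ.card := by
      refine le_of_mul_le_mul_right ?_ hf0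
      calc ((3 * m).choose m : ℤ) * rothNumberNat (3 * f) * f
          = ((3 * m).choose m : ℤ) * f * rothNumberNat (3 * f) := by ring
        _ ≤ 2 * (12 * (f : ℤ)) ^ 2 * Δ.card := h3
        _ = 288 * (f : ℤ) * Δ.card * f := by ring
    rw [← hf]
    exact_mod_cast h4

end Support

/-! ## The Kronecker power restricts to many independent matrix products -/

section Tensor

/-- **`T_cw,q^{⊗3m} ≥ ⟨p_m⟩ ⊗ ⟨q^m, q^m, q^m⟩` with `288 C(2m,m) p_m ≥ C(3m,m) · rothNumberNat(3 C(2m,m))`**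
(BCS p. 381: `⊕_{Δ} t^{⊗N}(x,y,z) ≤ t^{⊗N}`, `|Δ| ≥ C min binom`, each component
`≃ ⟨q^{N/3},q^{N/3},q^{N/3}⟩`; here as a genuine restriction, by zeroing out along the free diagonal of
`exists_free_balanced_diagonal` and `cw_kroneckerPow_blocks`).
[cite: BurgisserClausenShokrollahi1997, Thm. 15.41 (proof, p. 381)] -/
theorem exists_restrictsTo_cw_kroneckerPow (K : Type u) [CommSemiring K] (q m : ℕ) (hm : 1 ≤ m) :
    ∃ p : ℕ, (3 * m).choose m * rothNumberNat (3 * (2 * m).choose m) ≤ 288 * (2 * m).choose m * p ∧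
      TensorRestrictsTo (kroneckerPow (cwTensor K q) (3 * m))
        (kroneckerTensor (unitTensor K p) (matMulTensor K (q ^ m) (q ^ m) (q ^ m))) := by
  classical
  obtain ⟨Δ, hcard, hpart, hfree, hsize⟩ := exists_free_balanced_diagonal m hm
  obtain ⟨F, G, H, hFGH⟩ := cw_kroneckerPow_blocks K q m (3 * m) Δ hcard hpart hfree
  refine ⟨Δ.card, hsize, ?_⟩
  rw [hFGH]
  exact tensorRestrictsTo_precomp _ F G H

end Tensor

/-! ## Elementary analysis -/

section Analysis

/-- `C(3m, m) ≥ (27/4)^m / (3m+1)` (the largest term of the binomial expansion of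
`(1/3 + 2/3)^{3m}`; BCS (15.40) / Bläser p. 46 use Stirling: `(1/N) log binom(N, 2N/3) → H(1/3)`).
[folklore] -/
theorem pow_le_mul_choose_three_mul (m : ℕ) :
    ((27 : ℝ) / 4) ^ m ≤ (3 * m + 1) * ((3 * m).choose m : ℝ) := by
  induction m with
  | zero => simp
  | succ m ih =>
    -- `C(3m+3, m+1) (m+1)(2m+2)(2m+1) = (3m+3)(3m+2)(3m+1) C(3m, m)`
    have h1 := Nat.choose_mul_succ_eq (3 * m) m       -- C(3m,m)(3m+1) = C(3m+1,m)(2m+1)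
    have h2 := Nat.choose_mul_succ_eq (3 * m + 1) m   -- C(3m+1,m)(3m+2) = C(3m+2,m)(2m+2)
    have h3 := Nat.add_one_mul_choose_eq (3 * m + 2) m   -- (3m+3) C(3m+2,m) = C(3m+3,m+1)(m+1)
    have e1 : 3 * m + 1 - m = 2 * m + 1 := by omega
    have e2 : 3 * m + 1 + 1 - m = 2 * m + 2 := by omega
    rw [e1] at h1
    rw [e2] at h2
    have h1' : ((3 * m).choose m : ℝ) * (3 * m + 1) = ((3 * m + 1).choose m : ℝ) * (2 * m + 1) := by
      exact_mod_cast h1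
    have h2' : ((3 * m + 1).choose m : ℝ) * (3 * m + 2) = ((3 * m + 2).choose m : ℝ) * (2 * m + 2) := by
      exact_mod_cast h2
    have h3' : ((3 * m + 3 : ℕ) : ℝ) * ((3 * m + 2).choose m : ℝ) =
        ((3 * m + 3).choose (m + 1) : ℝ) * (m + 1) := by
      exact_mod_cast h3
    have e3 : 3 * (m + 1) = 3 * m + 3 := by ring
    rw [e3]
    set C0 := ((3 * m).choose m : ℝ)
    set C1 := ((3 * m + 1).choose m : ℝ)
    set C2 := ((3 * m + 2).choose m : ℝ)
    set C3 := ((3 * m + 3).choose (m + 1) : ℝ)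
    have hC0 : 0 ≤ C0 := Nat.cast_nonneg _
    have hm0 : (0 : ℝ) ≤ m := Nat.cast_nonneg _
    push_cast at h3' ⊢
    -- `C3 (m+1)(2m+2)(2m+1) = (3m+3)(3m+2)(3m+1) C0`
    have hrel : C3 * ((m + 1) * ((2 * m + 2) * (2 * m + 1))) =
        (3 * m + 3) * ((3 * m + 2) * ((3 * m + 1) * C0)) := by
      calc C3 * ((m + 1) * ((2 * m + 2) * (2 * m + 1)))
          = (C3 * (m + 1)) * (2 * m + 2) * (2 * m + 1) := by ring
        _ = ((3 * m + 3) * C2) * (2 * m + 2) * (2 * m + 1) := by rw [← h3']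
        _ = (3 * m + 3) * (C2 * (2 * m + 2)) * (2 * m + 1) := by ring
        _ = (3 * m + 3) * (C1 * (3 * m + 2)) * (2 * m + 1) := by rw [← h2']
        _ = (3 * m + 3) * (3 * m + 2) * (C1 * (2 * m + 1)) := by ring
        _ = (3 * m + 3) * (3 * m + 2) * (C0 * (3 * m + 1)) := by rw [← h1']
        _ = (3 * m + 3) * ((3 * m + 2) * ((3 * m + 1) * C0)) := by ring
    -- compare after multiplying by `D = (m+1)(2m+2)(2m+1) > 0`
    have hD : (0 : ℝ) < (m + 1) * ((2 * m + 2) * (2 * m + 1)) := by positivity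
    refine le_of_mul_le_mul_right ?_ hD
    calc ((27 : ℝ) / 4) ^ (m + 1) * (((m : ℝ) + 1) * ((2 * (m : ℝ) + 2) * (2 * (m : ℝ) + 1)))
        = 27 / 4 * (((m : ℝ) + 1) * ((2 * (m : ℝ) + 2) * (2 * (m : ℝ) + 1))) * ((27 : ℝ) / 4) ^ m := by
          ring
      _ ≤ 27 / 4 * (((m : ℝ) + 1) * ((2 * (m : ℝ) + 2) * (2 * (m : ℝ) + 1))) * ((3 * (m : ℝ) + 1) * C0) :=
          mul_le_mul_of_nonneg_left ih (by positivity)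
      _ ≤ (3 * (m : ℝ) + 3 + 1) * ((3 * (m : ℝ) + 3) * ((3 * (m : ℝ) + 2) * ((3 * (m : ℝ) + 1) * C0))) := by
          have key : (3 * (m : ℝ) + 3 + 1) * ((3 * (m : ℝ) + 3) * ((3 * (m : ℝ) + 2) *
              ((3 * (m : ℝ) + 1) * C0))) -
              27 / 4 * (((m : ℝ) + 1) * ((2 * (m : ℝ) + 2) * (2 * (m : ℝ) + 1))) * ((3 * (m : ℝ) + 1) * C0)
              = (3 * (m : ℝ) + 1) * C0 * (((m : ℝ) + 1) * (27 / 2 * (m : ℝ) + 21 / 2)) := by ring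
          have hnn : 0 ≤ (3 * (m : ℝ) + 1) * C0 * (((m : ℝ) + 1) * (27 / 2 * (m : ℝ) + 21 / 2)) := by
            positivity
          linarith
      _ = (3 * (m : ℝ) + 3 + 1) * C3 * (((m : ℝ) + 1) * ((2 * (m : ℝ) + 2) * (2 * (m : ℝ) + 1))) := by
          rw [← hrel]; ring
      _ = (3 * ((m : ℝ) + 1) + 1) * C3 * (((m : ℝ) + 1) * ((2 * (m : ℝ) + 2) * (2 * (m : ℝ) + 1))) := by
          ring

/-- Square roots are eventually dominated by any linear function. [folklore] -/
theorem exists_nat_forall_sqrt_le (c c' κ : ℝ) (hκ : 0 < κ) :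
    ∃ m₀ : ℕ, ∀ m : ℕ, m₀ ≤ m → c * √(m : ℝ) + c' ≤ κ * m := by
  set T := ((|c| + |c'|) / κ) ^ 2 with hT
  refine ⟨⌈T⌉₊ + 1, fun m hm => ?_⟩
  have hm1 : (1 : ℝ) ≤ m := by exact_mod_cast (by omega : 1 ≤ m)
  have hmT : T ≤ m := (Nat.le_ceil T).trans (by exact_mod_cast (by omega : ⌈T⌉₊ ≤ m))
  have hs1 : 1 ≤ √(m : ℝ) := by rw [← Real.sqrt_one]; exact Real.sqrt_le_sqrt hm1
  have hs0 : 0 < √(m : ℝ) := by linarith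
  have hsT : (|c| + |c'|) / κ ≤ √(m : ℝ) := by
    rw [← Real.sqrt_sq (by positivity : 0 ≤ (|c| + |c'|) / κ), ← hT]
    exact Real.sqrt_le_sqrt hmT
  have hk : |c| + |c'| ≤ κ * √(m : ℝ) := by rwa [div_le_iff₀ hκ, mul_comm] at hsT
  calc c * √(m : ℝ) + c' ≤ |c| * √(m : ℝ) + |c'| * √(m : ℝ) := by
        nlinarith [le_abs_self c, le_abs_self c', abs_nonneg c', hs1, hs0]
    _ = (|c| + |c'|) * √(m : ℝ) := by ring
    _ ≤ (κ * √(m : ℝ)) * √(m : ℝ) := mul_le_mul_of_nonneg_right hk hs0.le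
    _ = κ * m := by rw [mul_assoc, Real.mul_self_sqrt (by positivity)]

/-- If `A m ≤ B m + c √m + c'` for all large `m`, then `A ≤ B`. [folklore] -/
theorem le_of_forall_large_mul_le {A B c c' : ℝ}
    (h : ∃ m₀ : ℕ, ∀ m : ℕ, m₀ ≤ m → A * m ≤ B * m + c * √(m : ℝ) + c') : A ≤ B := by
  refine le_of_forall_pos_le_add fun η hη => ?_
  obtain ⟨m₀, hm₀⟩ := h
  obtain ⟨m₁, hm₁⟩ := exists_nat_forall_sqrt_le c c' η hη
  set m := max (max m₀ m₁) 1 with hm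
  have h1 := hm₀ m (by omega)
  have h2 := hm₁ m (by omega)
  have hmpos : (0 : ℝ) < m := by exact_mod_cast (by omega : 0 < m)
  refine le_of_mul_le_mul_right ?_ hmpos
  linarith

/-- `log x ≤ 2 √x` for `x > 0`. [folklore] -/
theorem log_le_two_mul_sqrt {x : ℝ} (hx : 0 < x) : Real.log x ≤ 2 * √x := by
  have h := Real.log_le_sub_one_of_pos (Real.sqrt_pos.2 hx)
  rw [Real.log_sqrt hx.le] at h
  linarith [Real.sqrt_nonneg x]

/-- `exp 2 > 27/4` (so `log(27/4) < 2 ≤ ω`), and `log 3, log 4 ≤ 2`. [folklore] -/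
theorem exp_two_gt : (27 : ℝ) / 4 < Real.exp 2 := by
  have := Real.exp_one_gt_d9
  have h2 : Real.exp 2 = Real.exp 1 * Real.exp 1 := by rw [← Real.exp_add]; norm_num
  nlinarith

end Analysis

/-! ## The theorem -/

section Main

/-- **Coppersmith–Winograd 1990 / BCS Ex. 15.24(7) / CGLV 2022 p. 4: `ω ≤ log_q(4 R̃(T_cw,q)³/27)`**,
in the growth-bound form of `CoppersmithWinograd1990_asymptoticRank_form` — DISCHARGE of that named
fact. Proof (restriction-only laser method): for `N = 3m`, `T_cw,q^{⊗N} ≥ ⟨p_m⟩ ⊗ ⟨q^m,q^m,q^m⟩`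
with `p_m ≥ C(3m,m) 2^{-o(m)}` (`exists_restrictsTo_cw_kroneckerPow`: balanced support, the
hashing theorem BCS 15.39 with a Salem–Spencer diagonal, Behrend); with `a = ⌊(p_m/C_δ)^{1/(ω+δ)}⌋`,
`R(⟨a,a,a⟩) ≤ p_m`, so `(a q^m)^ω ≤ R(⟨aq^m,aq^m,aq^m⟩) ≤ R(T^{⊗N}) ≤ C_ε ρ^{(1+ε)N}`
(rank step of the asymptotic sum inequality, BCS p. 380); `m → ∞`, `δ, ε → 0` give
`log(27/4) + ω log q ≤ 3 log ρ`. [cite: ConnerGesmundoLandsbergVentura2022, Thm. 1.1 and p. 3 (BCS97 Ex. 15.24)] -/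
theorem CoppersmithWinograd1990_asymptoticRank_form_holds :
    CoppersmithWinograd1990_asymptoticRank_form := by
  intro q hq ρ hρ hyp
  have hyp' : ∀ ε : ℝ, 0 < ε →
      (fun N : ℕ => (tensorRank (kroneckerPow (cwTensor ℂ q) N) : ℝ)) =O[atTop]
        fun N : ℕ => ρ ^ ((1 + ε) * N) := hyp
  clear hyp
  have hq1 : (1 : ℝ) < q := by exact_mod_cast hq
  have hq0 : (0 : ℝ) < q := by positivity
  have hlogq : 0 < Real.log q := Real.log_pos hq1
  have hω2 : 2 ≤ omega ℂ := omega_two_le ℂ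
  have hω0 : 0 < omega ℂ := by linarith
  obtain ⟨L, hL⟩ : ∃ L : ℝ, L = Real.log (27 / 4) := ⟨_, rfl⟩
  have hL0 : 0 < L := hL ▸ Real.log_pos (by norm_num)
  have hL2 : L < 2 := by rw [hL, Real.log_lt_iff_lt_exp (by norm_num)]; exact exp_two_gt
  have hlog3 : Real.log 3 ≤ 2 := by
    rw [Real.log_le_iff_le_exp (by norm_num)]; linarith [exp_two_gt]
  have hlog4 : Real.log 4 ≤ 2 := by
    rw [Real.log_le_iff_le_exp (by norm_num)]; linarith [exp_two_gt]
  -- MAIN CLAIM: for all `ε, δ > 0`, `ω (L/(ω+δ) + log q) ≤ 3 (1+ε) log ρ`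
  have main : ∀ ε : ℝ, 0 < ε → ∀ δ : ℝ, 0 < δ →
      omega ℂ * (L / (omega ℂ + δ) + Real.log q) ≤ 3 * (1 + ε) * Real.log ρ := by
    intro ε hε δ hδ
    have hωδ : 0 < omega ℂ + δ := by linarith
    -- the constant of the hypothesis
    obtain ⟨Cε, hCε, hb⟩ := bound_of_isBigO_nat_atTop (hyp' ε hε)
    have hrank : ∀ N : ℕ, (tensorRank (kroneckerPow (cwTensor ℂ q) N) : ℝ) ≤
        Cε * ρ ^ ((1 + ε) * N) := by
      intro N
      have hg : ρ ^ ((1 + ε) * N) ≠ 0 := (Real.rpow_pos_of_pos hρ _).ne'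
      have := hb hg
      rwa [Real.norm_of_nonneg (Nat.cast_nonneg _),
        Real.norm_of_nonneg (Real.rpow_pos_of_pos hρ _).le] at this
    -- `ω` is an exponent
    obtain ⟨Cδ, hCδ, hCδb⟩ := exists_tensorRank_matMulTensor_le_rpow ℂ hδ
    -- the restrictions `T^{⊗3m} ≥ ⟨P m⟩ ⊗ ⟨q^m,q^m,q^m⟩`
    have hP : ∀ m : ℕ, 1 ≤ m → ∃ p : ℕ,
        (3 * m).choose m * rothNumberNat (3 * (2 * m).choose m) ≤ 288 * (2 * m).choose m * p ∧
        TensorRestrictsTo (kroneckerPow (cwTensor ℂ q) (3 * m))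
          (kroneckerTensor (unitTensor ℂ p) (matMulTensor ℂ (q ^ m) (q ^ m) (q ^ m))) :=
      fun m hm => exists_restrictsTo_cw_kroneckerPow ℂ q m hm
    choose! P hPsize hPres using hP
    -- (E3) `log (P m) ≥ m L - 12 √m - log 96` for `m ≥ 1`
    have hE3 : ∀ m : ℕ, 1 ≤ m → 0 < (P m : ℝ) ∧
        (m : ℝ) * L - 12 * √(m : ℝ) - Real.log 96 ≤ Real.log (P m) := by
      intro m hm
      have hm1 : (1 : ℝ) ≤ m := by exact_mod_cast hm
      set f := (2 * m).choose m with hf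
      have hf1 : 1 ≤ f := Nat.choose_pos (by omega)
      have hf0 : (0 : ℝ) < f := by exact_mod_cast hf1
      have hf4 : (f : ℝ) ≤ 4 ^ m := by
        have : f ≤ 2 ^ (2 * m) := Nat.choose_le_two_pow _ _
        calc (f : ℝ) ≤ ((2 ^ (2 * m) : ℕ) : ℝ) := by exact_mod_cast this
          _ = 4 ^ m := by push_cast; rw [pow_mul]; norm_num
      -- Behrend
      have hB := Behrend.roth_lower_bound (N := 3 * f)
      have hsize : ((3 * m).choose m : ℝ) * rothNumberNat (3 * f) ≤ 288 * f * P m := by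
        exact_mod_cast hPsize m hm
      set s : ℝ := 4 * √(Real.log ((3 * f : ℕ) : ℝ)) with hs
      have hexp : 0 < Real.exp (-s) := Real.exp_pos _
      have hB' : ((3 * f : ℕ) : ℝ) * Real.exp (-s) ≤ rothNumberNat (3 * f) := by
        rw [hs, show -(4 * √(Real.log ((3 * f : ℕ) : ℝ))) = -4 * √(Real.log ((3 * f : ℕ) : ℝ)) by ring]
        exact hB
      have hC0 : (0 : ℝ) ≤ (3 * m).choose m := Nat.cast_nonneg _
      -- `C e^{-s} ≤ 96 P`
      have h1 : ((3 * m).choose m : ℝ) * Real.exp (-s) ≤ 96 * P m := by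
        have h3f : (0 : ℝ) < ((3 * f : ℕ) : ℝ) := by positivity
        refine le_of_mul_le_mul_right ?_ h3f
        calc ((3 * m).choose m : ℝ) * Real.exp (-s) * ((3 * f : ℕ) : ℝ)
            = ((3 * m).choose m : ℝ) * (((3 * f : ℕ) : ℝ) * Real.exp (-s)) := by ring
          _ ≤ ((3 * m).choose m : ℝ) * rothNumberNat (3 * f) := mul_le_mul_of_nonneg_left hB' hC0
          _ ≤ 288 * f * P m := hsize
          _ = 96 * P m * ((3 * f : ℕ) : ℝ) := by push_cast; ring
      have hP0 : 0 < (P m : ℝ) := by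
        have : 0 < ((3 * m).choose m : ℝ) * Real.exp (-s) :=
          mul_pos (by exact_mod_cast Nat.choose_pos (by omega)) hexp
        linarith
      refine ⟨hP0, ?_⟩
      -- `(27/4)^m e^{-s} ≤ 96 (3m+1) P`
      have h2 : ((27 : ℝ) / 4) ^ m * Real.exp (-s) ≤ 96 * (3 * m + 1) * P m := by
        calc ((27 : ℝ) / 4) ^ m * Real.exp (-s) ≤ (3 * m + 1) * ((3 * m).choose m : ℝ) * Real.exp (-s) :=
              mul_le_mul_of_nonneg_right (pow_le_mul_choose_three_mul m) hexp.le
          _ = (3 * m + 1) * (((3 * m).choose m : ℝ) * Real.exp (-s)) := by ring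
          _ ≤ (3 * m + 1) * (96 * P m) := mul_le_mul_of_nonneg_left h1 (by positivity)
          _ = 96 * (3 * m + 1) * P m := by ring
      have h3 : (m : ℝ) * L - s ≤ Real.log 96 + Real.log (3 * m + 1) + Real.log (P m) := by
        have hlhs : Real.log (((27 : ℝ) / 4) ^ m * Real.exp (-s)) = m * L - s := by
          rw [Real.log_mul (by positivity) hexp.ne', Real.log_pow, Real.log_exp, hL]; ring
        have hrhs : Real.log (96 * (3 * m + 1) * P m) =
            Real.log 96 + Real.log (3 * m + 1) + Real.log (P m) := by
          rw [Real.log_mul (by positivity) hP0.ne', Real.log_mul (by norm_num) (by positivity)]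
        rw [← hlhs, ← hrhs]
        exact Real.log_le_log (by positivity) h2
      -- `s ≤ 8 √m` and `log (3m+1) ≤ 4 √m`
      have hs8 : s ≤ 8 * √(m : ℝ) := by
        have hlog3f : Real.log ((3 * f : ℕ) : ℝ) ≤ 4 * m := by
          have : ((3 * f : ℕ) : ℝ) ≤ 3 * 4 ^ m := by push_cast; linarith
          calc Real.log ((3 * f : ℕ) : ℝ) ≤ Real.log (3 * 4 ^ m) :=
                Real.log_le_log (by positivity) this
            _ = Real.log 3 + m * Real.log 4 := by
                rw [Real.log_mul (by norm_num) (by positivity), Real.log_pow]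
            _ ≤ 2 + m * 2 := by nlinarith
            _ ≤ 4 * m := by linarith
        have : √(Real.log ((3 * f : ℕ) : ℝ)) ≤ 2 * √(m : ℝ) := by
          calc √(Real.log ((3 * f : ℕ) : ℝ)) ≤ √(4 * m) := Real.sqrt_le_sqrt hlog3f
            _ = 2 * √(m : ℝ) := by
                rw [Real.sqrt_mul (by norm_num), show (4 : ℝ) = 2 ^ 2 by norm_num,
                  Real.sqrt_sq (by norm_num)]
        rw [hs]; linarith
      have hl4 : Real.log (3 * m + 1) ≤ 4 * √(m : ℝ) := by
        calc Real.log (3 * m + 1) ≤ 2 * √(3 * m + 1) := log_le_two_mul_sqrt (by positivity)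
          _ ≤ 2 * √(4 * m) := by
              refine mul_le_mul_of_nonneg_left (Real.sqrt_le_sqrt (by linarith)) (by norm_num)
          _ = 4 * √(m : ℝ) := by
              rw [Real.sqrt_mul (by norm_num), show (4 : ℝ) = 2 ^ 2 by norm_num,
                Real.sqrt_sq (by norm_num)]; ring
      linarith
    -- the threshold beyond which `P m / Cδ ≥ 2^{ω+δ}`
    obtain ⟨m₁, hm₁⟩ := exists_nat_forall_sqrt_le 12
      (Real.log 96 + Real.log Cδ + (omega ℂ + δ) * Real.log 2) L hL0
    -- the inequality for large `m`
    refine le_of_forall_large_mul_le (c := 12 * (omega ℂ / (omega ℂ + δ)))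
      (c' := omega ℂ / (omega ℂ + δ) * (Real.log 96 + Real.log Cδ) + omega ℂ * Real.log 2 +
        Real.log Cε) ⟨max m₁ 1, fun m hm => ?_⟩
    have hm1 : 1 ≤ m := le_trans (le_max_right _ _) hm
    have hmm₁ : m₁ ≤ m := le_trans (le_max_left _ _) hm
    obtain ⟨hP0, hlogP⟩ := hE3 m hm1
    have hthr := hm₁ m hmm₁
    -- `X = (P/Cδ)^{1/(ω+δ)} ≥ 2`
    set X : ℝ := ((P m : ℝ) / Cδ) ^ (omega ℂ + δ)⁻¹ with hX
    have hPC : 0 < (P m : ℝ) / Cδ := div_pos hP0 hCδ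
    have hX0 : 0 ≤ X := Real.rpow_nonneg hPC.le _
    have hlogX : Real.log X = (Real.log (P m) - Real.log Cδ) / (omega ℂ + δ) := by
      rw [hX, Real.log_rpow hPC, Real.log_div hP0.ne' hCδ.ne']; ring
    have hX2 : 2 ≤ X := by
      have h2 : (2 : ℝ) ^ (omega ℂ + δ) ≤ (P m : ℝ) / Cδ := by
        rw [← Real.log_le_log_iff (by positivity) hPC, Real.log_rpow (by norm_num),
          Real.log_div hP0.ne' hCδ.ne']
        linarith
      calc (2 : ℝ) = ((2 : ℝ) ^ (omega ℂ + δ)) ^ (omega ℂ + δ)⁻¹ :=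
            (Real.rpow_rpow_inv (by norm_num) hωδ.ne').symm
        _ ≤ X := Real.rpow_le_rpow (by positivity) h2 (inv_nonneg.2 hωδ.le)
    -- `a = ⌊X⌋`
    set a : ℕ := ⌊X⌋₊ with ha
    have ha2 : 2 ≤ a := Nat.le_floor (by exact_mod_cast hX2)
    have haX : (a : ℝ) ≤ X := Nat.floor_le hX0
    have haX' : X / 2 ≤ a := by have := Nat.lt_floor_add_one X; linarith
    have ha0 : (0 : ℝ) < a := by exact_mod_cast (by omega : 0 < a)
    -- `R(⟨a,a,a⟩) ≤ P m`
    have hap : tensorRank (matMulTensor ℂ a a a) ≤ P m := by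
      have h1 := hCδb a (by omega)
      have h2 : (a : ℝ) ^ (omega ℂ + δ) ≤ X ^ (omega ℂ + δ) :=
        Real.rpow_le_rpow ha0.le haX hωδ.le
      have h3 : X ^ (omega ℂ + δ) = (P m : ℝ) / Cδ := by
        rw [hX]; exact Real.rpow_inv_rpow hPC.le hωδ.ne'
      have h4 : (tensorRank (matMulTensor ℂ a a a) : ℝ) ≤ P m := by
        calc (tensorRank (matMulTensor ℂ a a a) : ℝ) ≤ Cδ * (a : ℝ) ^ (omega ℂ + δ) := h1
          _ ≤ Cδ * X ^ (omega ℂ + δ) := mul_le_mul_of_nonneg_left h2 hCδ.le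
          _ = P m := by rw [h3]; field_simp
      exact_mod_cast h4
    -- (E1) `(a q^m)^ω ≤ Cε ρ^{(1+ε) 3m}`
    have hqm : (2 : ℕ) ≤ q ^ m := le_trans hq (Nat.le_self_pow (by omega) q)
    have haq : 2 ≤ a * q ^ m := le_trans hqm (Nat.le_mul_of_pos_left _ (by omega))
    have hE1 := (rpow_omega_mul_le_tensorRank_of_restrictsTo ℂ _ (hPres m hm1) hap haq).trans
      (hrank (3 * m))
    have haq0 : (0 : ℝ) < (a : ℝ) * (q : ℝ) ^ m := by positivity
    have hE1' : omega ℂ * (Real.log a + m * Real.log q) ≤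
        Real.log Cε + (1 + ε) * ((3 * m : ℕ) : ℝ) * Real.log ρ := by
      have hl := Real.log_le_log (Real.rpow_pos_of_pos (by positivity) _) hE1
      rw [Real.log_rpow (by positivity), Real.log_mul hCε.ne' (Real.rpow_pos_of_pos hρ _).ne',
        Real.log_rpow hρ] at hl
      have : Real.log (((a * q ^ m : ℕ) : ℝ)) = Real.log a + m * Real.log q := by
        push_cast
        rw [Real.log_mul ha0.ne' (by positivity), Real.log_pow]
      rw [this] at hl
      linarith
    -- (E2) `log a ≥ log X - log 2`
    have hE2 : Real.log X - Real.log 2 ≤ Real.log a := by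
      have := Real.log_le_log (by linarith) haX'
      rwa [Real.log_div (by linarith) (by norm_num)] at this
    -- combine
    have hκ : 0 < omega ℂ / (omega ℂ + δ) := div_pos hω0 hωδ
    have hcomb : omega ℂ * ((m * L - 12 * √(m : ℝ) - Real.log 96 - Real.log Cδ) / (omega ℂ + δ)
        - Real.log 2) + omega ℂ * (m * Real.log q) ≤
        Real.log Cε + 3 * (1 + ε) * Real.log ρ * m := by
      have h1 : (m * L - 12 * √(m : ℝ) - Real.log 96 - Real.log Cδ) / (omega ℂ + δ) ≤
          Real.log X := by
        rw [hlogX]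
        exact div_le_div_of_nonneg_right (by linarith) hωδ.le
      have h2 : omega ℂ * ((m * L - 12 * √(m : ℝ) - Real.log 96 - Real.log Cδ) / (omega ℂ + δ)
          - Real.log 2) ≤ omega ℂ * Real.log a :=
        mul_le_mul_of_nonneg_left (by linarith) hω0.le
      have h3 : ((3 * m : ℕ) : ℝ) = 3 * m := by push_cast; ring
      rw [h3] at hE1'
      nlinarith [hE1', h2]
    have e1 : omega ℂ * ((m * L - 12 * √(m : ℝ) - Real.log 96 - Real.log Cδ) / (omega ℂ + δ)
        - Real.log 2) + omega ℂ * (m * Real.log q) =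
        omega ℂ * (L / (omega ℂ + δ) + Real.log q) * m -
        (12 * (omega ℂ / (omega ℂ + δ)) * √(m : ℝ) +
          (omega ℂ / (omega ℂ + δ) * (Real.log 96 + Real.log Cδ) + omega ℂ * Real.log 2)) := by
      field_simp
      ring
    rw [e1] at hcomb
    linarith
  -- from the main claim: `L - δ + ω log q ≤ 3(1+ε) log ρ`
  have main' : ∀ ε : ℝ, 0 < ε → ∀ δ : ℝ, 0 < δ →
      L - δ + omega ℂ * Real.log q ≤ 3 * (1 + ε) * Real.log ρ := by
    intro ε hε δ hδ
    have h := main ε hε δ hδ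
    have hωδ : 0 < omega ℂ + δ := by linarith
    have h1 : L - δ ≤ omega ℂ * (L / (omega ℂ + δ)) := by
      rw [mul_div_assoc', le_div_iff₀ hωδ]
      nlinarith
    nlinarith
  -- `L + ω log q ≤ 3 log ρ`
  have key : L + omega ℂ * Real.log q ≤ 3 * Real.log ρ := by
    refine le_of_forall_pos_le_add fun η hη => ?_
    set ε : ℝ := η / (2 * (3 * |Real.log ρ| + 1)) with hε
    have hε0 : 0 < ε := by positivity
    have h := main' ε hε0 (η / 2) (by positivity)
    have h1 : 3 * ε * Real.log ρ ≤ η / 2 := by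
      calc 3 * ε * Real.log ρ ≤ 3 * ε * |Real.log ρ| :=
            mul_le_mul_of_nonneg_left (le_abs_self _) (by positivity)
        _ = η / 2 * (3 * |Real.log ρ| / (3 * |Real.log ρ| + 1)) := by rw [hε]; field_simp
        _ ≤ η / 2 * 1 := by
            refine mul_le_mul_of_nonneg_left ?_ (by positivity)
            rw [div_le_one (by positivity)]; linarith
        _ = η / 2 := mul_one _
    nlinarith
  -- conclusion
  have hy : 0 < 4 * ρ ^ 3 / 27 := by positivity
  rw [Real.le_logb_iff_rpow_le hq1 hy, ← Real.log_le_log_iff (Real.rpow_pos_of_pos hq0 _) hy,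
    Real.log_rpow hq0]
  have : Real.log (4 * ρ ^ 3 / 27) = 3 * Real.log ρ - L := by
    rw [hL, Real.log_div (by positivity) (by norm_num), Real.log_mul (by norm_num) (by positivity),
      Real.log_pow, Real.log_div (by norm_num) (by norm_num)]
    push_cast; ring
  rw [this]
  linarith

end Main

/-! ## The rank form `ω ≤ log_q((4/27) R(T_cw,q^{⊠k})^{3/k})` (CGLV Thm. 1.1 with `R` for `bR`) -/

section RankForm

variable {K : Type u} [CommSemiring K] {ι κ μ : Type*}

/-- `t^{⊗(m+n)}` is the relabelling of `t^{⊗m} ⊗ t^{⊗n}` along the splitting of `Fin (m+n)` into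
`Fin m` and `Fin n` (`Fin.castAdd`, `Fin.natAdd`) (CGLV §1: Kronecker powers "defined iteratively").
[cite: ConnerGesmundoLandsbergVentura2022, §1 (p. 3)] -/
theorem kroneckerPow_add_eq_precomp (t : ι → κ → μ → K) (m n : ℕ) :
    kroneckerPow t (m + n) = fun a b c =>
      kroneckerTensor (kroneckerPow t m) (kroneckerPow t n)
        (fun i => a (Fin.castAdd n i), fun i => a (Fin.natAdd m i))
        (fun i => b (Fin.castAdd n i), fun i => b (Fin.natAdd m i))
        (fun i => c (Fin.castAdd n i), fun i => c (Fin.natAdd m i)) := by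
  funext a b c
  simp only [kroneckerPow_apply, kroneckerTensor_apply, Fin.prod_univ_add]

/-- **`R(t^{⊗(m+n)}) ≤ R(t^{⊗m}) · R(t^{⊗n})`** (CGLV p. 3: "`R(T ⊠ T') ≤ R(T) R(T')`"; Bläser 2013,
Lemma 5.8, after the relabelling `kroneckerPow_add_eq_precomp`).
[cite: ConnerGesmundoLandsbergVentura2022, §1 (p. 3)] -/
theorem tensorRank_kroneckerPow_add_le [Fintype ι] [Fintype κ] [Fintype μ] (t : ι → κ → μ → K)
    (m n : ℕ) : tensorRank (kroneckerPow t (m + n)) ≤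
      tensorRank (kroneckerPow t m) * tensorRank (kroneckerPow t n) := by
  rw [kroneckerPow_add_eq_precomp]
  exact (tensorRank_precomp_le _ _ _ _).trans (Blaser2013_lemma58 _ _)

/-- `R(t^{⊗0}) ≤ 1` (`t^{⊗0}` is the constant `1` on singleton index types). [folklore] -/
theorem tensorRank_kroneckerPow_zero_le_one (t : ι → κ → μ → K) :
    tensorRank (kroneckerPow t 0) ≤ 1 := by
  refine tensorRank_le_of_eq_sum (fun _ _ => 1) (fun _ _ => 1) (fun _ _ => 1) ?_
  funext a b c
  rw [sum_triad_apply]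
  simp

/-- **`R(t^{⊗(k d)}) ≤ R(t^{⊗k})^d`** (iterate `tensorRank_kroneckerPow_add_le`).
[cite: ConnerGesmundoLandsbergVentura2022, §1 (p. 3)] -/
theorem tensorRank_kroneckerPow_mul_le_pow [Fintype ι] [Fintype κ] [Fintype μ]
    (t : ι → κ → μ → K) (k d : ℕ) :
    tensorRank (kroneckerPow t (k * d)) ≤ tensorRank (kroneckerPow t k) ^ d := by
  induction d with
  | zero =>
    rw [mul_zero, pow_zero]
    exact tensorRank_kroneckerPow_zero_le_one t
  | succ d ih =>
    rw [mul_add_one, pow_succ]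
    exact (tensorRank_kroneckerPow_add_le t _ _).trans (Nat.mul_le_mul_right _ ih)

/-- Kronecker powers of the little Coppersmith–Winograd tensor are non-zero (the entry at
`(0…0, q…q, q…q)` is `1`), so `R(T_cw,q^{⊗k}) ≥ 1` for `q ≥ 1`. [folklore] -/
theorem one_le_tensorRank_kroneckerPow_cwTensor {L : Type u} [Field L] (q k : ℕ) (hq : 1 ≤ q) :
    1 ≤ tensorRank (kroneckerPow (cwTensor L q) k) := by
  by_contra hlt
  have h0 : tensorRank (kroneckerPow (cwTensor L q) k) = 0 := by omega
  obtain ⟨w, u, v, e⟩ := exists_triad_decomposition_tensorRank (kroneckerPow (cwTensor L q) k)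
  have hj : (Fin.last q : Fin (q + 1)) ≠ 0 := by
    intro h'
    have := congrArg Fin.val h'
    simp only [Fin.val_last, Fin.val_zero] at this
    omega
  have h1 : kroneckerPow (cwTensor L q) k (fun _ => 0) (fun _ => Fin.last q) (fun _ => Fin.last q)
      = 1 := by
    simp only [kroneckerPow_apply, cwTensor_zero_left L q hj, Finset.prod_const_one]
  have : IsEmpty (Fin (tensorRank (kroneckerPow (cwTensor L q) k))) := by rw [h0]; infer_instance
  have h2 := congrFun (congrFun (congrFun e (fun _ => 0)) (fun _ => Fin.last q)) (fun _ => Fin.last q)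
  rw [h1, sum_triad_apply] at h2
  simp at h2

/-- **Growth of the ranks of the Kronecker powers from one power**: with `r = R(T_cw,q^{⊗k})`,
`ρ = r^{1/k}` and `M = max(1, R(T_cw,q^{⊗1}))`, `R(T_cw,q^{⊗N}) ≤ M^k ρ^N` for all `N`
(`N = k⌊N/k⌋ + (N mod k)`, submultiplicativity; CGLV p. 3: `R̃(T) ≤ R(T^{⊠k})^{1/k}`).
[cite: ConnerGesmundoLandsbergVentura2022, §1 (p. 3)] -/
theorem tensorRank_kroneckerPow_cwTensor_le (q k : ℕ) (hq : 1 ≤ q) (hk : 1 ≤ k) (N : ℕ) :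
    (tensorRank (kroneckerPow (cwTensor ℂ q) N) : ℝ) ≤
      ((max 1 (tensorRank (kroneckerPow (cwTensor ℂ q) 1)) : ℕ) : ℝ) ^ k *
        ((tensorRank (kroneckerPow (cwTensor ℂ q) k) : ℝ) ^ ((k : ℝ)⁻¹)) ^ N := by
  set T := cwTensor ℂ q with hT
  set r : ℕ := tensorRank (kroneckerPow T k) with hr
  set M : ℕ := max 1 (tensorRank (kroneckerPow T 1)) with hM
  have hr1 : 1 ≤ r := one_le_tensorRank_kroneckerPow_cwTensor q k hq
  have hr0 : (0 : ℝ) < r := by exact_mod_cast hr1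
  have hr1' : (1 : ℝ) ≤ r := by exact_mod_cast hr1
  set ρ : ℝ := (r : ℝ) ^ ((k : ℝ)⁻¹) with hρ
  have hρ1 : 1 ≤ ρ := Real.one_le_rpow hr1' (inv_nonneg.2 (Nat.cast_nonneg _))
  have hρk : ρ ^ k = (r : ℝ) := Real.rpow_inv_natCast_pow hr0.le (by omega)
  have hM1 : 1 ≤ M := le_max_left _ _
  have hN := Nat.div_add_mod N k
  have h1 : tensorRank (kroneckerPow T N) ≤ r ^ (N / k) * M ^ k := by
    have h := tensorRank_kroneckerPow_add_le T (k * (N / k)) (N % k)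
    rw [hN] at h
    refine h.trans (Nat.mul_le_mul (tensorRank_kroneckerPow_mul_le_pow T k (N / k)) ?_)
    calc tensorRank (kroneckerPow T (N % k)) = tensorRank (kroneckerPow T (1 * (N % k))) := by
          rw [one_mul]
      _ ≤ tensorRank (kroneckerPow T 1) ^ (N % k) := tensorRank_kroneckerPow_mul_le_pow T 1 _
      _ ≤ M ^ (N % k) := Nat.pow_le_pow_left (le_max_right _ _) _
      _ ≤ M ^ k := Nat.pow_le_pow_right hM1 (Nat.mod_lt N (by omega)).le
  have h2 : (r : ℝ) ^ (N / k) ≤ ρ ^ N := by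
    rw [← hρk, ← pow_mul]
    exact pow_le_pow_right₀ hρ1 (Nat.mul_div_le N k)
  calc (tensorRank (kroneckerPow T N) : ℝ) ≤ ((r ^ (N / k) * M ^ k : ℕ) : ℝ) := by exact_mod_cast h1
    _ = (r : ℝ) ^ (N / k) * (M : ℝ) ^ k := by push_cast; ring
    _ ≤ ρ ^ N * (M : ℝ) ^ k := mul_le_mul_of_nonneg_right h2 (by positivity)
    _ = (M : ℝ) ^ k * ρ ^ N := mul_comm _ _

/-- **Coppersmith–Winograd 1990, rank form: `ω ≤ log_q((4/27) R(T_cw,q^{⊠k})^{3/k})`, `q ≥ 2`,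
`k ≥ 1`** — DISCHARGE of the named fact `CoppersmithWinograd1990_rank_form` (CGLV 2022, Thm. 1.1 =
arXiv Thm. 1.2, with the rank `R ≥ bR` in place of the border rank; CGLV p. 4: "[BCS] pointed out
that the statement holds with `bR(T^{⊠k})^{3/k}` replaced by `R̃(T_cw,q)^3`"). Proof: with
`r = R(T_cw,q^{⊠k}) ≥ 1` and `ρ = r^{1/k} ≥ 1`, submultiplicativity of the rank gives
`R(T_cw,q^{⊗N}) ≤ M^k ρ^N ≤ M^k ρ^{(1+ε)N}` (`tensorRank_kroneckerPow_cwTensor_le`), which is the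
hypothesis of the (proved) asymptotic-rank form `CoppersmithWinograd1990_asymptoticRank_form_holds`;
its conclusion `ω ≤ log_q(4ρ³/27)` is the claim since `ρ³ = r^{3/k}`.
[cite: ConnerGesmundoLandsbergVentura2022, Thm. 1.1 (arXiv Thm. 1.2) and p. 4] -/
theorem CoppersmithWinograd1990_rank_form_holds : CoppersmithWinograd1990_rank_form := by
  intro q k hq hk
  change omega ℂ ≤ Real.logb q ((4 / 27) *
    ((tensorRank (kroneckerPow (cwTensor ℂ q) k) : ℝ) ^ ((3 : ℝ) / k)))
  have hq1 : 1 ≤ q := by omega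
  set r : ℕ := tensorRank (kroneckerPow (cwTensor ℂ q) k) with hr
  have hr1 : 1 ≤ r := one_le_tensorRank_kroneckerPow_cwTensor q k hq1
  have hr0 : (0 : ℝ) < r := by exact_mod_cast hr1
  have hr1' : (1 : ℝ) ≤ r := by exact_mod_cast hr1
  set ρ : ℝ := (r : ℝ) ^ ((k : ℝ)⁻¹) with hρ
  have hρ1 : 1 ≤ ρ := Real.one_le_rpow hr1' (inv_nonneg.2 (Nat.cast_nonneg _))
  have hρ0 : 0 < ρ := by linarith
  set M : ℕ := max 1 (tensorRank (kroneckerPow (cwTensor ℂ q) 1)) with hM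
  -- the hypothesis of the asymptotic-rank form
  have hyp : ∀ ε : ℝ, 0 < ε →
      (fun N : ℕ => (tensorRank (kroneckerPow (cwTensor ℂ q) N) : ℝ)) =O[atTop]
        fun N : ℕ => ρ ^ ((1 + ε) * N) := by
    intro ε hε
    refine Asymptotics.IsBigO.of_bound ((M : ℝ) ^ k) (Filter.Eventually.of_forall fun N => ?_)
    rw [Real.norm_of_nonneg (Nat.cast_nonneg _),
      Real.norm_of_nonneg (Real.rpow_pos_of_pos hρ0 _).le]
    calc (tensorRank (kroneckerPow (cwTensor ℂ q) N) : ℝ) ≤ (M : ℝ) ^ k * ρ ^ N :=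
          tensorRank_kroneckerPow_cwTensor_le q k hq1 hk N
      _ ≤ (M : ℝ) ^ k * ρ ^ ((1 + ε) * N) := by
          refine mul_le_mul_of_nonneg_left ?_ (by positivity)
          calc ρ ^ N = ρ ^ (N : ℝ) := (Real.rpow_natCast ρ N).symm
            _ ≤ ρ ^ ((1 + ε) * N) := Real.rpow_le_rpow_of_exponent_le hρ1
                (le_mul_of_one_le_left (Nat.cast_nonneg N) (by linarith))
  have h := CoppersmithWinograd1990_asymptoticRank_form_holds q hq ρ hρ0 hyp
  have hρ3 : ρ ^ 3 = (r : ℝ) ^ ((3 : ℝ) / k) := by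
    rw [hρ, ← Real.rpow_natCast, ← Real.rpow_mul hr0.le]
    congr 1
    push_cast
    ring
  have e : 4 * ρ ^ 3 / 27 = 4 / 27 * (r : ℝ) ^ ((3 : ℝ) / k) := by rw [hρ3]; ring
  rwa [e] at h

end RankForm

end Literature.Computability.AlgebraicComplexity

end
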